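import Summits.CriticalPhenomena.PercolationContinuityZ3.Theses.PercNearOneGluing
import Summits.CriticalPhenomena.PercolationContinuityZ3.Theorems.PercNearOneGluingAdditiveGluingSpectatorEdgeBHK
import Literature.Probability.Percolation.TwoSetExchange
import HarnessLib

/-!
# Crux `PercNearOneGluing.AdditiveGluing` (stmt-CriticalPhenomena-4576), line `tieline`: the K₀ gain transfer
# (registered stub `stub_k0GainTransfer_c9`)

Support file (`--supports stmt-CriticalPhenomena-4576`, lead c9).  No definitions, no named facts, no sorries.

Weighted graph on a finite vertex type (`μ = prodBernoulli w`), pair `{u, v}` glued at the target `b`, observer `o`,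
spectator `c`.  Write `J = {o ↔ c}`, `N_c = {c ↮ u} ∩ {c ↮ v}`, `D' = {c ↮ u}`, `I = {c ↮ u} ∩ {u ↮ v}` (the separation
event of the blocks `{c, v}` and `{u}`), `E_x = {u ↮ v} ∩ {v ↔ b} ∩ {x ↮ u}`.

**Gain transfer (`stub_k0GainTransfer_c9`).**  `μ(E_c) · μ(N_c ∩ J) ≤ μ(E_o) · μ(N_c)`.

Proof.  `E_c = I ∩ {v ↔ b}` and `I ∩ J ∩ {v ↔ b} ⊆ E_o` (if `o ↔ u` then `c ↔ o ↔ u`), so it suffices to show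
`μ(I ∩ {v↔b}) · μ(N_c ∩ J) ≤ μ(I ∩ J ∩ {v↔b}) · μ(N_c)`, the product of two van den Berg–Häggström–Kahn inequalities
in the event ("exchange") form landed in `Literature/Probability/Percolation/TwoClusterExchange.lean`, `TwoSetExchange.lean`:
* (A') `μ(I ∩ J) · μ(I ∩ {v↔b}) ≤ μ(I ∩ J ∩ {v↔b}) · μ(I)` — Thm. 2.1 at `q = 1` for the blocks `S = {c, v}`, `T = {u}`:
  `J = {c ↔ o}` and `{v ↔ b}` are both increasing in `C_S = C_c ∪ C_v`, hence positively correlated given `I = {S ↮ T}`;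
* (B') `μ(N_c ∩ J) · μ(I) ≤ μ(I ∩ J) · μ(N_c)` — Thm. 1.5 for `(C_c, C_u)` given `D' = {c ↮ u}` (the exchange
  inequality with `A₁ = J`, `A₂ = {u ↮ v}` of type `(+)` and `B₁ = {c ↮ v}` of type `(−)`): `I = D' ∩ {u ↮ v}`,
  `N_c = D' ∩ {c ↮ v}`; this is `P(J | N_c) ≤ P(J | D') ≤ P(J | I)` in one line (BHK Thm. 1.3 with `X = {u}`).
Multiplying and cancelling `μ(I) · μ(I ∩ J)` (zero cases are trivial) gives the claim; `c = u` is degenerate (`D' = ∅`).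
[cite: VandenbergHaggstromKahn2005, Thm. 1.3 (p. 6), Thm. 1.5 (p. 7), Thm. 2.1 (p. 9) at q = 1, Remark 1 after Thm. 1.2 (p. 5)]
[cite: KozmaNitzan2024, §2.2 (p. 5), the BHK inequalities for two clusters]
-/

namespace Summit.CriticalPhenomena.PercolationContinuityZ3.Cruxes.AdditiveGluing.TieLine

open MeasureTheory Set Literature.Probability.LatticeModels Literature.Probability.Percolation
open Summit.CriticalPhenomena.PercolationContinuityZ3.Theorems

noncomputable section

namespace K0GainTransfer

variable {V : Type*}

/-- The separation event of the blocks `{c, v}` and `{u}` is `{c ↮ u} ∩ {v ↮ u}`. [folklore] -/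
theorem setOf_sep_pair_singleton (c v u : V) :
    {ω : BondConfig V | ∀ s ∈ ({c, v} : Set V), ∀ t ∈ ({u} : Set V), ¬ (openGraph ω).Reachable s t} =
      (openConn c u)ᶜ ∩ (openConn v u)ᶜ := by
  ext ω
  simp only [mem_setOf_eq, mem_singleton_iff, forall_eq, forall_mem_insert, mem_inter_iff, mem_compl_iff,
    openConn]

variable [Fintype V]

/-- **(A')** BHK Thm. 2.1 (`q = 1`) for the blocks `S = {c, v}`, `T = {u}`: given `I = {c ↮ u} ∩ {v ↮ u}`, the events
`J = {c ↔ o}` and `{v ↔ b}` (both increasing in `C_S`) are positively correlated: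
`μ(I ∩ J) · μ(I ∩ {v↔b}) ≤ μ(I ∩ (J ∩ {v↔b})) · μ(I)`.
[cite: VandenbergHaggstromKahn2005, Thm. 2.1 (p. 9) at q = 1, Remark 1 after Thm. 1.2 (p. 5)] -/
theorem bhk_linkA' (w : Sym2 V → unitInterval) (o b u v c : V) :
    (prodBernoulli w).real ((openConn c u)ᶜ ∩ (openConn v u)ᶜ ∩ openConn c o) *
        (prodBernoulli w).real ((openConn c u)ᶜ ∩ (openConn v u)ᶜ ∩ openConn v b) ≤
      (prodBernoulli w).real ((openConn c u)ᶜ ∩ (openConn v u)ᶜ ∩ (openConn c o ∩ openConn v b)) *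
        (prodBernoulli w).real ((openConn c u)ᶜ ∩ (openConn v u)ᶜ : Set (BondConfig V)) := by
  have key := setTwoClusterExchange w ({c, v} : Set V) ({u} : Set V)
    (A₁ := openConn c o) (A₂ := openConn v b) (B₁ := univ) (B₂ := univ)
    (TwoSetExchange.typePlus_openConn_of_mem {c, v} {u} (mem_insert c {v}) o)
    (TwoSetExchange.typePlus_openConn_of_mem {c, v} {u} (mem_insert_of_mem c (mem_singleton v)) b)
    (fun _ _ _ _ _ => mem_univ _) (fun _ _ _ _ _ => mem_univ _)
  rw [setOf_sep_pair_singleton c v u] at key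
  simpa only [inter_univ, univ_inter] using key

/-- **(B')** BHK Thm. 1.5 for `(C_c, C_u)` given `D' = {c ↮ u}` (`c ≠ u`), exchange form with `A₁ = J = {c ↔ o}`,
`A₂ = {u ↮ v}` (type `(+)`), `B₁ = {c ↮ v}` (type `(−)`):
`μ(D' ∩ (J ∩ {c↮v})) · μ(D' ∩ {u↮v}) ≤ μ(D' ∩ (J ∩ {u↮v})) · μ(D' ∩ {c↮v})`, i.e. `P(J | N_c) ≤ P(J | I)`.
[cite: VandenbergHaggstromKahn2005, Thm. 1.3 (p. 6), Thm. 1.5 (p. 7)] -/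
theorem bhk_linkB' (w : Sym2 V → unitInterval) (o u v c : V) (hcu : c ≠ u) :
    (prodBernoulli w).real ((openConn c u)ᶜ ∩ (openConn c o ∩ (openConn c v)ᶜ)) *
        (prodBernoulli w).real ((openConn c u)ᶜ ∩ (openConn u v)ᶜ : Set (BondConfig V)) ≤
      (prodBernoulli w).real ((openConn c u)ᶜ ∩ (openConn c o ∩ (openConn u v)ᶜ)) *
        (prodBernoulli w).real ((openConn c u)ᶜ ∩ (openConn c v)ᶜ) := by
  have key := twoClusterExchange w hcu
    (A₁ := openConn c o) (A₂ := (openConn u v)ᶜ) (B₁ := (openConn c v)ᶜ) (B₂ := univ)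
    (typePlus_openConn c u o) (typePlus_not_openConn c u v)
    (typeMinus_not_openConn c u v) (fun _ _ _ _ _ => mem_univ _)
  simpa only [inter_univ, univ_inter] using key

/-- **Chain (A')·(B')** (one measure, any weights, `c ≠ u`): with `I = {c ↮ u} ∩ {u ↮ v}`, `D' = {c ↮ u}`,
`J = {c ↔ o}`, `N_c = D' ∩ {c ↮ v}`: `μ(I ∩ {v↔b}) · μ(N_c ∩ J) ≤ μ(I ∩ (J ∩ {v↔b})) · μ(N_c)` — division-free form of
`P(J | I ∩ {v↔b}) ≥ P(J | I) ≥ P(J | N_c)`.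
[cite: VandenbergHaggstromKahn2005, Thm. 1.3 (p. 6), Thm. 1.5 (p. 7), Thm. 2.1 (p. 9) at q = 1] -/
theorem chain (w : Sym2 V → unitInterval) (o b u v c : V) (hcu : c ≠ u) :
    (prodBernoulli w).real ((openConn c u)ᶜ ∩ (openConn u v)ᶜ ∩ openConn v b) *
        (prodBernoulli w).real ((openConn c u)ᶜ ∩ (openConn c o ∩ (openConn c v)ᶜ)) ≤
      (prodBernoulli w).real ((openConn c u)ᶜ ∩ (openConn u v)ᶜ ∩ (openConn c o ∩ openConn v b)) *
        (prodBernoulli w).real ((openConn c u)ᶜ ∩ (openConn c v)ᶜ : Set (BondConfig V)) := by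
  have hA := bhk_linkA' w o b u v c
  have hB := bhk_linkB' w o u v c hcu
  rw [KNPreFKG.openConn_symm v u] at hA
  have s1 : ((openConn c u)ᶜ ∩ (openConn c o ∩ (openConn u v)ᶜ) : Set (BondConfig V)) =
      (openConn c u)ᶜ ∩ (openConn u v)ᶜ ∩ openConn c o := by
    rw [inter_assoc, inter_comm (openConn c o)]
  rw [s1] at hB
  set μ := prodBernoulli w with hμ
  set e := μ.real ((openConn c u)ᶜ ∩ (openConn u v)ᶜ ∩ openConn v b) with he
  set nj := μ.real ((openConn c u)ᶜ ∩ (openConn c o ∩ (openConn c v)ᶜ)) with hnj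
  set x := μ.real ((openConn c u)ᶜ ∩ (openConn u v)ᶜ ∩ (openConn c o ∩ openConn v b)) with hx
  set nn := μ.real ((openConn c u)ᶜ ∩ (openConn c v)ᶜ : Set (BondConfig V)) with hnn
  set i := μ.real ((openConn c u)ᶜ ∩ (openConn u v)ᶜ : Set (BondConfig V)) with hi
  set ij := μ.real ((openConn c u)ᶜ ∩ (openConn u v)ᶜ ∩ openConn c o) with hij
  -- hA : ij * e ≤ x * i,  hB : nj * i ≤ ij * nn
  have he0 : 0 ≤ e := measureReal_nonneg
  have hnj0 : 0 ≤ nj := measureReal_nonneg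
  have hx0 : 0 ≤ x := measureReal_nonneg
  have hnn0 : 0 ≤ nn := measureReal_nonneg
  have hi0 : 0 ≤ i := measureReal_nonneg
  have hij0 : 0 ≤ ij := measureReal_nonneg
  have he_le : e ≤ i := measureReal_mono inter_subset_left
  by_cases hiz : i = 0
  · have he' : e = 0 := le_antisymm (he_le.trans hiz.le) he0
    rw [he', zero_mul]
    exact mul_nonneg hx0 hnn0
  have hipos : 0 < i := lt_of_le_of_ne hi0 (Ne.symm hiz)
  by_cases hijz : ij = 0
  · rw [hijz, zero_mul] at hB
    have hB' : nj * i ≤ 0 * i := by rwa [zero_mul]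
    have hnj' : nj = 0 := le_antisymm (le_of_mul_le_mul_right hB' hipos) hnj0
    rw [hnj', mul_zero]
    exact mul_nonneg hx0 hnn0
  have hijpos : 0 < ij := lt_of_le_of_ne hij0 (Ne.symm hijz)
  have h : e * nj * (ij * i) ≤ x * nn * (ij * i) :=
    calc e * nj * (ij * i) = (ij * e) * (nj * i) := by ring
      _ ≤ (x * i) * (ij * nn) := mul_le_mul hA hB (mul_nonneg hnj0 hi0) (mul_nonneg hx0 hi0)
      _ = x * nn * (ij * i) := by ring
  exact le_of_mul_le_mul_right h (mul_pos hijpos hipos)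

end K0GainTransfer

namespace K0GainTransfer

variable {n : ℕ}

/-- `E_c = {u ↮ v} ∩ {v ↔ b} ∩ {c ↮ u} = ({c ↮ u} ∩ {u ↮ v}) ∩ {v ↔ b}`. [folklore] -/
theorem gain_eq (b u v c : Fin n) :
    ((openConn u v)ᶜ ∩ openConn v b ∩ (openConn c u)ᶜ : Set (BondConfig (Fin n))) =
      (openConn c u)ᶜ ∩ (openConn u v)ᶜ ∩ openConn v b := by
  rw [inter_comm, ← inter_assoc]

/-- `{c ↮ u} ∩ {u ↮ v} ∩ {c ↔ o} ∩ {v ↔ b} ⊆ E_o = {u ↮ v} ∩ {v ↔ b} ∩ {o ↮ u}` (if `o ↔ u` then `c ↔ o ↔ u`).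
[folklore] -/
theorem gain_obs_subset (o b u v c : Fin n) :
    ((openConn c u)ᶜ ∩ (openConn u v)ᶜ ∩ (openConn c o ∩ openConn v b) : Set (BondConfig (Fin n))) ⊆
      (openConn u v)ᶜ ∩ openConn v b ∩ (openConn o u)ᶜ := by
  intro ω hω
  simp only [mem_inter_iff, mem_compl_iff, openConn, mem_setOf_eq] at hω ⊢
  obtain ⟨⟨hcu, huv⟩, hco, hvb⟩ := hω
  exact ⟨⟨huv, hvb⟩, fun hou => hcu (hco.trans hou)⟩

end K0GainTransfer

open K0GainTransfer in
/-- **Registered stub `stub_k0GainTransfer_c9`** (K₀ gain transfer; line `tieline`, crux `AdditiveGluing`): with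
`J = {o ↔ c}`, `N_c = {c ↮ u} ∩ {c ↮ v}`, `E_x = {u ↮ v} ∩ {v ↔ b} ∩ {x ↮ u}`:  `μ(E_c) · μ(N_c ∩ J) ≤ μ(E_o) · μ(N_c)`.
Two vdBHK inequalities (`K0GainTransfer.chain`: blocks `{c, v}` / `{u}`, then `(C_c, C_u)`) plus the inclusion
`{c↮u} ∩ {u↮v} ∩ J ∩ {v↔b} ⊆ E_o`; `c = u` is degenerate (`{c ↮ c} = ∅`).
[cite: VandenbergHaggstromKahn2005, Thm. 1.3 (p. 6), Thm. 1.5 (p. 7), Thm. 2.1 (p. 9) at q = 1]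
[cite: KozmaNitzan2024, §2.2 (p. 5)] -/
theorem stub_k0GainTransfer_c9 : ∀ (n : ℕ) (w : Sym2 (Fin n) → unitInterval) (o b u v c : Fin n), (Literature.Probability.LatticeModels.prodBernoulli w).real ((Literature.Probability.Percolation.openConn u v)ᶜ ∩ Literature.Probability.Percolation.openConn v b ∩ (Literature.Probability.Percolation.openConn c u)ᶜ : Set (Literature.Probability.Percolation.BondConfig (Fin n))) * (Literature.Probability.LatticeModels.prodBernoulli w).real ((Literature.Probability.Percolation.openConn c u)ᶜ ∩ (Literature.Probability.Percolation.openConn c v)ᶜ ∩ Literature.Probability.Percolation.openConn o c : Set (Literature.Probability.Percolation.BondConfig (Fin n))) ≤ (Literature.Probability.LatticeModels.prodBernoulli w).real ((Literature.Probability.Percolation.openConn u v)ᶜ ∩ Literature.Probability.Percolation.openConn v b ∩ (Literature.Probability.Percolation.openConn o u)ᶜ : Set (Literature.Probability.Percolation.BondConfig (Fin n))) * (Literature.Probability.LatticeModels.prodBernoulli w).real ((Literature.Probability.Percolation.openConn c u)ᶜ ∩ (Literature.Probability.Percolation.openConn c v)ᶜ : Set (Literature.Probability.Percolation.BondConfig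 (Fin n))) := by
  intro n w o b u v c
  by_cases hcu : c = u
  · subst hcu
    simp only [SpectatorEdgeBHK.compl_openConn_self, inter_empty, empty_inter, measureReal_empty, mul_zero, le_refl]
  -- `N_c ∩ {o ↔ c} = {c ↮ u} ∩ ({c ↔ o} ∩ {c ↮ v})` (this is `K0AttachTransfer.slack_inter_eq` of the sibling file)
  have hs : ((openConn c u)ᶜ ∩ (openConn c v)ᶜ ∩ openConn o c : Set (BondConfig (Fin n))) =
      (openConn c u)ᶜ ∩ (openConn c o ∩ (openConn c v)ᶜ) := by
    rw [KNPreFKG.openConn_symm o c, inter_assoc, inter_comm ((openConn c v)ᶜ)]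
  rw [gain_eq b u v c, hs]
  calc (prodBernoulli w).real ((openConn c u)ᶜ ∩ (openConn u v)ᶜ ∩ openConn v b) *
        (prodBernoulli w).real ((openConn c u)ᶜ ∩ (openConn c o ∩ (openConn c v)ᶜ))
      ≤ (prodBernoulli w).real ((openConn c u)ᶜ ∩ (openConn u v)ᶜ ∩ (openConn c o ∩ openConn v b)) *
        (prodBernoulli w).real ((openConn c u)ᶜ ∩ (openConn c v)ᶜ : Set (BondConfig (Fin n))) :=
        chain w o b u v c hcu
    _ ≤ (prodBernoulli w).real ((openConn u v)ᶜ ∩ openConn v b ∩ (openConn o u)ᶜ) *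
        (prodBernoulli w).real ((openConn c u)ᶜ ∩ (openConn c v)ᶜ : Set (BondConfig (Fin n))) :=
        mul_le_mul_of_nonneg_right (measureReal_mono (gain_obs_subset o b u v c)) measureReal_nonneg

end

end Summit.CriticalPhenomena.PercolationContinuityZ3.Cruxes.AdditiveGluing.TieLine
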